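import Mathlib
import HarnessLib
import Summits.QuantumFields.YangMills.Theorems.LangevinControlUVOSLegsFromFemtoAndGapDefs

/-! # NT (stmt-QuantumFields-19353, `BalabanLadder.NT`) — a NON-GAUSSIAN first rung, TYPED (plan-only)

**What this is.** HOURLY-YM risk (c) / LADDER-YM R2a: every BC5 witness filed so far for an NT vehicle is a
FREE-FIELD (lattice Maxwell) rung, where clause (ii) of `LowerBounds` (the third-cumulant floor, `|Q3| ≥ ε`) is
identically false (`maxwellRing3_eq_zero`), so no vehicle has ever exhibited the SHAPE of the non-Gaussianity clause
on a non-Gaussian model.  This file TYPES the first such rung over NT's OWN objects (`dens`, `torusE`, `torusK3` of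
`…Cruxes.OSLegsFromFemtoAndGap.DlrCollarTransfer`) in the one regime where the true 4-D non-abelian model is under
rigorous control in the tree: STRONG COUPLING (`0 < β < β₀`), at LATTICE-scale separations, UNIFORMLY IN THE TORUS.

* `SkewFloorSU2`   — `G = SU(2)`, `r` = fundamental Wilson: `c β³ ≤ κ₃^{torus 2L+1}(dens_{e₀}, dens_{e₁}, dens_{e₂})`
  for all `0 < β < β₀` and ALL `L ≥ L₀` (three action densities at three corners of the unit cube in directions
  `0,1,2`; expected `c = 2^{2-6} = 1/16`: the unique closed plaquette set of size ≤ 6 through the three cube faces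
  `p₁₂(e₀), p₀₂(e₁), p₀₁(e₂)` is the cube boundary, the action supplies its three faces at `0` at order `β³`, and
  `E_Haar ∏_{f ∈ ∂cube} tr U_{∂f} = d^{χ(S²) - F} = 2^{-4}` by character gluing);
* `MirrorFloorSU2` — the clause-(i) companion: `c β⁸ ≤ Cov^{torus}(dens_{e₀}, dens_{-e₀})` (time-mirror pair; the
  three `2×1×1` boxes `[-1,1]₀×[0,1]_a×[0,1]_b`, expected `c = 9·2^{-8}`);
* `SkewFloor`      — the same cubic floor for EVERY compact simple `G` and EVERY faithful unitary `r` (NT's binders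
  verbatim), `c(G,r) = E_Haar ∏_{f∈∂cube}(Re tr r(U_{∂f}) - m) > 0` by Peter–Weyl-lite (each irreducible constituent
  `α` contributes `(m_α/2)^6 d_α^{-4}·#orientations > 0`).

**Why it is a witness in the BC5 sense.** Strong coupling is OUTSIDE S's regime (no continuum limit, no unit map:
NT is a weak-coupling statement) and outside every free-field regime (the Wilson measure at `β < β₀` is as far from
Gaussian as it gets: `κ₃ ≍ β³` while `κ₂ ≍ β⁴…β⁸` at these separations — skewness of order `β^{-3}` in units of
`κ₂^{3/2}`).  It exercises the (ii)-clause lever of every vehicle whose deciding crux carries the cumulant floor on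
ALL large tori with a torus-independent `ε` (FixedTorusFirst `SomeTorusFloors`, StaticSourceWitness/FiniteRankMirror
residuals `SkewAt…`, UniversalDetector `SkewAtScheme`, LogConcaveChart `SkewAtChartUnit`): here `ε = cβ³` at fixed
`β`, uniform in `L` — exactly the quantifier shape `∃ε ∀L ≥ L₀` that killed the YM₂/topological pseudo-floors.

**How a prover closes it inside the tree (named tools, no new literature).**
(1) cumulant expansion at `β = 0`: `κ₃^{(L)}(β) = Σ_k β^k/k! Σ_{p₁…p_k} κ^{Haar}_{3+k}(dens,dens,dens,φ_{p₁},…,φ_{p_k})`,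
    `φ_p = Re tr r(U_p) - m`, with volume-uniform remainder from the tree's convergent strong-coupling cluster
    expansion (`StrongCouplingExpansion.clusterBound_holds`, `abs_truncated_le`; stabilised jets
    `StrongCouplingLimitTruncated.exists_truncated_limit_jets`, door theorem `truncated_ne_zero_near_zero_of_torusJet`
    for the limit-state reading);
(2) VANISHING below order 3 and UNIQUENESS at order 3: a joint Haar cumulant of plaquette functions vanishes unless the
    SET of distinct plaquettes has no private link (`StrongCouplingLeading.integral_prod_centred_eq_zero_of_private_edge`
    + independence of a private-link plaquette from all other links); closed plaquette sets in `ℤ⁴` (torus side ≥ 3)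
    have ≥ 6 elements with equality iff a unit-cube boundary, and the only cube with faces based at `e₀, e₁, e₂` is
    `[0,1]³` in directions `0,1,2` (finite geometric lemma, new, S-sized);
(3) the COEFFICIENT: `E_Haar ∏_{f∈∂cube} χ(U_{∂f}) = 2^{-4}` by five character gluings
    `∫ χ_n(AV) χ_n(V⁻¹B) dV = χ_n(AB)/(n+1)` (`SU2CharacterConvolution.integral_su2Char_mul_su2Char_inv_mul`, or
    `RepresentationTheory.CompactGroups.CharacterProjection.Schur.integral_character_mul_character_inv_mul` for general
    irreducible `r`) and `χ(U) = χ(U⁻¹)` on `SU(2)`.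
Sizes: (1) L (plumbing over existing expansion), (2) M, (3) M.  No summit, leg or spine crux is proved by a rung:
NT (19353), UV, IR stay open; this is the typed TARGET the director's lever asks for («a non-Gaussian first rung —
none typed»), filed by ym-idea-8 g4 (lens «dual»: the strong/weak-coupling duality of WHERE floors are theorems). -/

set_option autoImplicit false

noncomputable section

open Literature.MathematicalPhysics.QuantumFieldTheory Literature.MathematicalPhysics.QuantumLattice
open Summit.QuantumFields.YangMills.Cruxes.OSLegsFromFemtoAndGap.DlrCollarTransfer

namespace Summit.QuantumFields.YangMills.Cruxes.NT.Rung.StrongCoupling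

/-- The gauge group `SU(2)` as a type. -/
abbrev SU2 : Type := Matrix.specialUnitaryGroup (Fin 2) ℂ

/-- Wilson's fundamental lattice representation of `SU(2)` (tree `fundamentalRep`). -/
def su2Rep : LatticeRep SU2 :=
  ⟨2, fundamentalRep (Fin 2), continuous_fundamentalRep _, fundamentalRep_injective _, fundamentalRep_mem_unitaryGroup⟩

/-- The unit site vector `eᵢ ∈ ℤ⁴`. -/
def e (i : Fin 4) : Fin 4 → ℤ := Pi.single i 1

/-- **Rung (ii), SU(2)** — strong-coupling third-cumulant FLOOR of the action densities at the three corners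
`e₀, e₁, e₂` of the unit cube, uniformly in the torus `(ℤ/(2L+1))⁴`, `L ≥ L₀`: `c β³ ≤ κ₃`. -/
def SkewFloorSU2 : Prop :=
  letI : MeasurableSpace SU2 := borel SU2
  haveI : BorelSpace SU2 := ⟨rfl⟩
  ∃ β₀ c : ℝ, 0 < β₀ ∧ 0 < c ∧ ∃ L₀ : ℕ, ∀ β : ℝ, 0 < β → β < β₀ → ∀ L : ℕ, L₀ ≤ L →
    c * β ^ 3 ≤ torusK3 SU2 su2Rep β L (e 0) (e 1) (e 2)

/-- **Rung (i), SU(2)** — strong-coupling MIRROR covariance floor of the action densities at the time-mirror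
pair `e₀, -e₀`, uniformly in the torus: `c β⁸ ≤ Cov(dens_{e₀}, dens_{-e₀})`. -/
def MirrorFloorSU2 : Prop :=
  letI : MeasurableSpace SU2 := borel SU2
  haveI : BorelSpace SU2 := ⟨rfl⟩
  ∃ β₀ c : ℝ, 0 < β₀ ∧ 0 < c ∧ ∃ L₀ : ℕ, ∀ β : ℝ, 0 < β → β < β₀ → ∀ L : ℕ, L₀ ≤ L →
    c * β ^ 8 ≤ torusE SU2 su2Rep β L (fun U => dens SU2 su2Rep (e 0) U * dens SU2 su2Rep (-(e 0)) U) -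
      torusE SU2 su2Rep β L (dens SU2 su2Rep (e 0)) * torusE SU2 su2Rep β L (dens SU2 su2Rep (-(e 0)))

/-- **Rung (ii), every compact simple `G`, every faithful unitary `r`** (NT's binders verbatim; the constant is
`E_Haar ∏_{f∈∂cube}(Re tr r(U_{∂f}) - m) > 0`). -/
def SkewFloor : Prop :=
  ∀ (G : Type) [Group G] [TopologicalSpace G] [IsTopologicalGroup G] [CompactSpace G],
    IsCompactSimpleLieGroup G → letI : MeasurableSpace G := borel G; haveI : BorelSpace G := ⟨rfl⟩;
    ∀ r : LatticeRep G, ∃ β₀ c : ℝ, 0 < β₀ ∧ 0 < c ∧ ∃ L₀ : ℕ, ∀ β : ℝ, 0 < β → β < β₀ → ∀ L : ℕ, L₀ ≤ L →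
      c * β ^ 3 ≤ torusK3 G r β L (e 0) (e 1) (e 2)

/-- PLAN-ONLY stub (BC5 `T3-plan-only` shape): the SU(2) skewness floor. Technique: (1)–(3) of the module docstring. -/
theorem stub_rung_skewFloorSU2 : SkewFloorSU2 := by
  sorry

/-- PLAN-ONLY stub: the SU(2) mirror floor (same technique, order `β⁸`, three boxes). -/
theorem stub_rung_mirrorFloorSU2 : MirrorFloorSU2 := by
  sorry

/-- PLAN-ONLY stub: the general-`G` skewness floor (adds Peter–Weyl-lite positivity of the cube coefficient). -/
theorem stub_rung_skewFloor : SkewFloor := by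
  sorry

/-- Bookkeeping (kernel-checked): the general floor specialises to `SU(2)` once `SU(2)` is registered as a compact
simple Lie group (tree: `isCompactSimpleLieGroup_specialUnitaryGroup` from the named fact
`isSimpleCompactGroup_specialUnitaryGroup`). -/
theorem skewFloorSU2_of_skewFloor (h : SkewFloor) (hSU2 : IsCompactSimpleLieGroup SU2) : SkewFloorSU2 :=
  h SU2 hSU2 su2Rep

end Summit.QuantumFields.YangMills.Cruxes.NT.Rung.StrongCoupling

end
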